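/-
Copyright (c) 2026 the pub-hodgecm-mathlib formalisation cell (harness21).  Prover seat hodgecm-mathlib-K2E1-p16 (g2), Track B «K2-LIT» ENGINE E1, h413 = `stmt-HodgeConjecture-24833`,
route `HCCMUnconditional`, R90-S8 «ContSpec-n½» #2∕#3 chain, deal S8-R94 (1) (S8 dealer R90-CS-plan (g2)): THE `hMSrel` PAYER «OF LETTERS» — the THREE-SCALAR diagonal
Maass–Selberg relation `‖Λ^T Ẽ_χ(z)‖² = R_χ(z, z)` of the truncated χ-family of `U(2,1)` off the real axis near a real pole, from the inner-product formula on the tube.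
-/
import Summits.HodgeConjecture.HodgeConjecture.Theorems.K2E1MaassSelbergContinuedOnCMThree     -- ★ (K2E1-p11) brings ★ `pairing_of_differentiableOn`, ★ `eqOn_prod_of_separately_differentiableOn`, ★ `differentiableOn_conj_comp_conj`, ★ denominators
import Summits.HodgeConjecture.HodgeConjecture.Theorems.K2E1MaassSelbergDiagonalLowerCMThree    -- ★ (K2E4-p14) the lower-half reflection pattern; brings `conj_ofReal_cpow`
import HarnessLib

/-!
# h413 ∕ R90-S8 #2∕#3 chain — `K2E1ChiMaassSelbergDiagonalCMThree`: THE THREE-SCALAR DIAGONAL MAASS–SELBERG RELATION OF THE TRUNCATED χ-FAMILY OFF THE REAL AXIS, FROM THE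
# INNER-PRODUCT FORMULA ON THE TUBE — the `hMSrel` letter of ★ `K2E1ChiEisensteinL2BoundMiddlePoleCMThree.msBound_of_chiRelation`

Cell `pub/hodgecm-mathlib`, crux H413 = `stmt-HodgeConjecture-24833`; S8 dealer R90-CS-plan (g2) S8-R94 (1); census `K2/K2E1-p16/g2/CENSUS-MSrel.md`.  Consumer chain: `hMSrel` ⇒ ★ p862829
`msBound_of_chiRelation` (`hMS`) ⇒ ★ p862783 `exists_L2Residue_of_section` ⇒ R90-C133-p02's `hr2` road ⇒ K2E2-p12's (V) seam.  THEOREMS ONLY (no `def`, no `instance`, no notation, no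
named-fact hypothesis, no `sorry`); lane `--supports stmt-HodgeConjecture-24833 --as helper` (count-neutral).  Pure complex analysis over a Hilbert-valued family `F : ℂ → H` (consumer:
`H := Lp ℂ 2 μ` on the `U(2,1)` quotient).

THE MATHEMATICS ([MoeglinWaldspurger1995, IV.2.3, IV.3.12 (a)]; [Arthur1980TraceFormulaII, §4]; [Langlands1976, §7]).  The ★ spherical diagonal road (K2E4-p14 ∕ K2E1-p11:
`K2E1MaassSelbergDiagonalFourTermCMThree.normSq_family_eq_fourTerm_on'`, lower twin `…DiagonalLowerCMThree`) turns the Maass–Selberg INNER-PRODUCT FORMULA on the convergence tube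
`2 < Re z′ < Re z` into the diagonal identity `‖F z‖² = R(z, z; c̃)` on a quarter-plane domain by the two-variable identity theorem (★ `eqOn_prod_of_separately_differentiableOn`) applied to
the pairing `Φ(z, z′) = ⟪F z′, F z⟫` (★ `pairing_of_differentiableOn`).  Everything there is REUSABLE BY NAME except the tube formula ★ `exists_fourTerm_tube_cm_three`, which is rank-one in
the section.  For the χ-family at a level the formula has the TWO-VARIABLE THREE-SCALAR shape
`⟪Λ^TẼ_χ(z′), Λ^TẼ_χ(z)⟫ = Cμ·CK·( a·T^{z+z̄′−2}∕(z+z̄′−2) + conj(w z′)·T^{z−z̄′}∕(z−z̄′) − w z·T^{−(z−z̄′)}∕(z−z̄′) − B z z′·T^{−(z+z̄′−2)}∕(z+z̄′−2) )`, `a = κm‖φ‖²`, `w z = κm⟨φ, M(z)φ⟩`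
(holomorphic), KERNEL `B z z′ = κm⟨M(z′)φ, M(z)φ⟩` (holomorphic in `z`, anti-holomorphic in `z′`; diagonal `B z z = β z = κm‖M(z)φ‖²`) — THE visible letter `hMStube` of this file.
Given it, the identity theorem gives `‖F z‖² = R_χ₂(z, z)` on an upper quarter-plane domain `D₁` (§2–§3) and, through the REFLECTED pairing `⟪F ū, F ū′⟫` and `conj` of the tube formula
(all structural constants real; `w♯ = conj∘w∘conj`, `B♯ u u′ = conj (B ū ū′)`), on a lower one (§4); on the diagonal the norms of the two right sides agree, so ★ p862829's single-`(w, β)`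
letter shape holds on both half-planes near the pole with `β z := B z z` (§5).
* §1 `conj_chiFourTerm₂` (algebra), `differentiableOn_chiFourTerm₂_fst` ∕ `differentiableOn_chiFourTerm₂_snd_conj` (separate holomorphy on `D₁ × conj⁻¹D₁`).
* §2 `diag_eq_chiFourTerm₂_of_pairing` — the identity theorem step.
* §3 **`normSq_family_eq_chiFourTerm_of_tube`** (upper), §4 **`normSq_family_eq_chiFourTerm_lower_of_tube`** (lower, by reflection).
* §5 HEAD **`msRel_of_tube_letters`** — ★ p862829's `hMSrel` near a real `z₀ > 1`: `∀ᶠ z in 𝓝[≠] z₀, Im z ≠ 0 → ‖F z‖² ≤ ‖R_χ(z; a, w z, B z z)‖`.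
HONEST LABEL: HC_CM is proved only modulo the 7 printed citations (2 remaining named inputs: hLiu418 = `stmt-HodgeConjecture-24832`, h413 = `stmt-HodgeConjecture-24833`) until rung 0
closes; this file asserts no named fact and closes no socket; it pays `hMSrel` MODULO the visible letters (T1) `hMStube` on both quarter-tubes (the χ Maass–Selberg inner-product formula —
χ-twin of ★ `exists_fourTerm_tube_cm_three`, L-class), (T2) holomorphy of `w`, `B` on the domains, (T3) the road's domain package (`F` holomorphic on `D₁ ∪ D₂`, boxes); count-neutral.

## References
* [MoeglinWaldspurger1995] C. Mœglin, J.-L. Waldspurger, *Spectral decomposition and Eisenstein series* (1995), IV.2.3, IV.3.12 (a).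
* [Arthur1980TraceFormulaII] J. Arthur, *A trace formula for reductive groups II*, Compositio Math. 40 (1980), §4.
* [Langlands1976] R. P. Langlands, *On the Functional Equations Satisfied by Eisenstein Series*, LNM 544 (1976), §7.
* [BernsteinLapid2019] J. Bernstein, E. Lapid, *On the meromorphic continuation of Eisenstein series*, J. AMS 37 (2024), §4.
-/

set_option autoImplicit false
-- the mandated namespace repeats `HodgeConjecture.HodgeConjecture`, as in every `Theorems/*.lean` of this sub-problem
set_option linter.dupNamespace false

noncomputable section

open Set Filter Topology Metric
open scoped ComplexConjugate InnerProductSpace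
open Literature.NumberTheory.EllipticCurves.ModularForms (conj_ofReal_cpow)
open Summit.HodgeConjecture.HodgeConjecture.Cruxes.H413.K2E1MaassSelbergContinuedCMTwo (differentiableOn_conj_comp_conj eqOn_prod_of_separately_differentiableOn)
open Summit.HodgeConjecture.HodgeConjecture.Cruxes.H413.K2E1MaassSelbergContinuedCMThree (add_sub_two_ne_zero_and_sub_ne_zero)
open Summit.HodgeConjecture.HodgeConjecture.Cruxes.H413.K2E1MaassSelbergContinuedOnCMThree (conj_mem_lower_of_mem)
open Summit.HodgeConjecture.HodgeConjecture.Cruxes.H413.K2E1MaassSelbergPairingCMTwo (pairing_of_differentiableOn)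

namespace Summit.HodgeConjecture.HodgeConjecture.Cruxes.H413.K2E1ChiMaassSelbergDiagonalCMThree

/-! ## §1 The two-variable three-scalar four-term: conjugation and separate holomorphy -/

/-- **CONJUGATION OF THE TWO-VARIABLE χ FOUR-TERM** (all structural constants real): `conj R_χ₂(ū, ū′; w, B) = R_χ₂(u, u′; w♯, B♯)` with `w♯ = conj ∘ w ∘ conj` and
`B♯ u u′ = conj (B ū ū′)` — the χ-twin of ★ `conj_fourTerm_three`. [cite: MoeglinWaldspurger1995, IV.2.3] -/
theorem conj_chiFourTerm₂ (Cμ CK a : ℝ) {T : ℝ} (hT : 0 ≤ T) (w : ℂ → ℂ) (B : ℂ → ℂ → ℂ) (u u' : ℂ) :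
    conj (((Cμ : ℝ) : ℂ) * (((CK : ℝ) : ℂ) *
        ((((T : ℝ) : ℂ) ^ (conj u + conj (conj u') - 2) / (conj u + conj (conj u') - 2)) * ((a : ℝ) : ℂ)
          + (((T : ℝ) : ℂ) ^ (conj u - conj (conj u')) / (conj u - conj (conj u'))) * conj (w (conj u'))
          - (((T : ℝ) : ℂ) ^ (-(conj u - conj (conj u'))) / (conj u - conj (conj u'))) * w (conj u)
          - (((T : ℝ) : ℂ) ^ (-(conj u + conj (conj u') - 2)) / (conj u + conj (conj u') - 2)) * B (conj u) (conj u')))) =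
      ((Cμ : ℝ) : ℂ) * (((CK : ℝ) : ℂ) *
        ((((T : ℝ) : ℂ) ^ (u + conj u' - 2) / (u + conj u' - 2)) * ((a : ℝ) : ℂ)
          + (((T : ℝ) : ℂ) ^ (u - conj u') / (u - conj u')) * conj (conj (w (conj u')))
          - (((T : ℝ) : ℂ) ^ (-(u - conj u')) / (u - conj u')) * conj (w (conj u))
          - (((T : ℝ) : ℂ) ^ (-(u + conj u' - 2)) / (u + conj u' - 2)) * conj (B (conj u) (conj u')))) := by
  simp only [map_mul, map_add, map_sub, map_div₀, map_neg, map_ofNat, conj_ofReal_cpow hT, Complex.conj_ofReal, Complex.conj_conj]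

/-- **`R_χ₂(·, z′)` IS HOLOMORPHIC IN `z ∈ D₁`** (`D₁ ⊆ D⁺ = {1 < Re, 0 < Im}`) for `conj w' = z′ ∈ D₁`, given `w` holomorphic on `D₁` and the kernel `B(·, z′)` holomorphic on `D₁`; in the
variables `(z, u = conj z′)` of the identity theorem.  Twin of ★ `differentiableOn_fourTerm_fst_on`. [cite: MoeglinWaldspurger1995, IV.3.12] -/
theorem differentiableOn_chiFourTerm₂_fst {D₁ : Set ℂ} (hD₁sub : D₁ ⊆ {z : ℂ | 1 < z.re ∧ 0 < z.im}) (Cμ CK a : ℝ) {T : ℝ} (hT : 0 < T)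
    {w : ℂ → ℂ} (hw : DifferentiableOn ℂ w D₁) {B : ℂ → ℂ → ℂ} (hB₁ : ∀ z' ∈ D₁, DifferentiableOn ℂ (fun z : ℂ => B z z') D₁)
    {u : ℂ} (hu : u ∈ {u : ℂ | conj u ∈ D₁}) :
    DifferentiableOn ℂ (fun z : ℂ =>
      ((Cμ : ℝ) : ℂ) * (((CK : ℝ) : ℂ) *
        ((((T : ℝ) : ℂ) ^ (z + u - 2) / (z + u - 2)) * ((a : ℝ) : ℂ)
          + (((T : ℝ) : ℂ) ^ (z - u) / (z - u)) * conj (w (conj u))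
          - (((T : ℝ) : ℂ) ^ (-(z - u)) / (z - u)) * w z
          - (((T : ℝ) : ℂ) ^ (-(z + u - 2)) / (z + u - 2)) * B z (conj u)))) D₁ := by
  have hT0 : ((T : ℝ) : ℂ) ≠ 0 := Complex.ofReal_ne_zero.2 hT.ne'
  have hu' : u ∈ {w : ℂ | 1 < w.re ∧ w.im < 0} := conj_mem_lower_of_mem hD₁sub hu
  have hne : ∀ z ∈ D₁, z + u - 2 ≠ 0 ∧ z - u ≠ 0 := fun z hz => add_sub_two_ne_zero_and_sub_ne_zero (hD₁sub hz) hu'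
  have hs₁ : DifferentiableOn ℂ (fun z : ℂ => z + u - 2) D₁ := (differentiableOn_id.add_const _).sub_const _
  have hs₂ : DifferentiableOn ℂ (fun z : ℂ => z - u) D₁ := differentiableOn_id.sub_const _
  have e₁ : DifferentiableOn ℂ (fun z : ℂ => ((T : ℝ) : ℂ) ^ (z + u - 2) / (z + u - 2)) D₁ := (hs₁.const_cpow (Or.inl hT0)).div hs₁ fun z hz => (hne z hz).1
  have e₂ : DifferentiableOn ℂ (fun z : ℂ => ((T : ℝ) : ℂ) ^ (z - u) / (z - u)) D₁ := (hs₂.const_cpow (Or.inl hT0)).div hs₂ fun z hz => (hne z hz).2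
  have e₃ : DifferentiableOn ℂ (fun z : ℂ => ((T : ℝ) : ℂ) ^ (-(z - u)) / (z - u)) D₁ := (hs₂.neg.const_cpow (Or.inl hT0)).div hs₂ fun z hz => (hne z hz).2
  have e₄ : DifferentiableOn ℂ (fun z : ℂ => ((T : ℝ) : ℂ) ^ (-(z + u - 2)) / (z + u - 2)) D₁ := (hs₁.neg.const_cpow (Or.inl hT0)).div hs₁ fun z hz => (hne z hz).1
  exact (((((e₁.mul_const _).add (e₂.mul_const _)).sub (e₃.mul hw)).sub (e₄.mul (hB₁ (conj u) hu))).const_mul _).const_mul _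

/-- **`R_χ₂(z, conj u)` IS HOLOMORPHIC IN `u ∈ conj⁻¹ D₁`** for `z ∈ D₁` (`D₁ ⊆ D⁺` open): the reflected scalar `u ↦ conj (w (conj u))` is holomorphic (★ `differentiableOn_conj_comp_conj`)
and the kernel clause `u ↦ B z (conj u)` is holomorphic by the letter `hB₂`.  Twin of ★ `differentiableOn_fourTerm_snd_conj_on`. [cite: MoeglinWaldspurger1995, IV.3.12] -/
theorem differentiableOn_chiFourTerm₂_snd_conj {D₁ : Set ℂ} (hD₁ : IsOpen D₁) (hD₁sub : D₁ ⊆ {z : ℂ | 1 < z.re ∧ 0 < z.im}) (Cμ CK a : ℝ) {T : ℝ} (hT : 0 < T)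
    {w : ℂ → ℂ} (hw : DifferentiableOn ℂ w D₁) {B : ℂ → ℂ → ℂ} (hB₂ : ∀ z ∈ D₁, DifferentiableOn ℂ (fun u : ℂ => B z (conj u)) {u : ℂ | conj u ∈ D₁})
    {z : ℂ} (hz : z ∈ D₁) :
    DifferentiableOn ℂ (fun u : ℂ =>
      ((Cμ : ℝ) : ℂ) * (((CK : ℝ) : ℂ) *
        ((((T : ℝ) : ℂ) ^ (z + u - 2) / (z + u - 2)) * ((a : ℝ) : ℂ)
          + (((T : ℝ) : ℂ) ^ (z - u) / (z - u)) * conj (w (conj u))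
          - (((T : ℝ) : ℂ) ^ (-(z - u)) / (z - u)) * w z
          - (((T : ℝ) : ℂ) ^ (-(z + u - 2)) / (z + u - 2)) * B z (conj u)))) {u : ℂ | conj u ∈ D₁} := by
  have hT0 : ((T : ℝ) : ℂ) ≠ 0 := Complex.ofReal_ne_zero.2 hT.ne'
  have hne : ∀ u ∈ {u : ℂ | conj u ∈ D₁}, z + u - 2 ≠ 0 ∧ z - u ≠ 0 := fun u hu => add_sub_two_ne_zero_and_sub_ne_zero (hD₁sub hz) (conj_mem_lower_of_mem hD₁sub hu)
  have hs₁ : DifferentiableOn ℂ (fun u : ℂ => z + u - 2) {u : ℂ | conj u ∈ D₁} := ((differentiableOn_const z).add differentiableOn_id).sub_const _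
  have hs₂ : DifferentiableOn ℂ (fun u : ℂ => z - u) {u : ℂ | conj u ∈ D₁} := (differentiableOn_const z).sub differentiableOn_id
  have e₁ : DifferentiableOn ℂ (fun u : ℂ => ((T : ℝ) : ℂ) ^ (z + u - 2) / (z + u - 2)) {u : ℂ | conj u ∈ D₁} := (hs₁.const_cpow (Or.inl hT0)).div hs₁ fun u hu => (hne u hu).1
  have e₂ : DifferentiableOn ℂ (fun u : ℂ => ((T : ℝ) : ℂ) ^ (z - u) / (z - u)) {u : ℂ | conj u ∈ D₁} := (hs₂.const_cpow (Or.inl hT0)).div hs₂ fun u hu => (hne u hu).2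
  have e₃ : DifferentiableOn ℂ (fun u : ℂ => ((T : ℝ) : ℂ) ^ (-(z - u)) / (z - u)) {u : ℂ | conj u ∈ D₁} := (hs₂.neg.const_cpow (Or.inl hT0)).div hs₂ fun u hu => (hne u hu).2
  have e₄ : DifferentiableOn ℂ (fun u : ℂ => ((T : ℝ) : ℂ) ^ (-(z + u - 2)) / (z + u - 2)) {u : ℂ | conj u ∈ D₁} := (hs₁.neg.const_cpow (Or.inl hT0)).div hs₁ fun u hu => (hne u hu).1
  have hws : DifferentiableOn ℂ (fun u : ℂ => conj (w (conj u))) {u : ℂ | conj u ∈ D₁} := differentiableOn_conj_comp_conj hD₁ hw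
  exact (((((e₁.mul_const _).add (e₂.mul hws)).sub (e₃.mul_const _)).sub (e₄.mul (hB₂ z hz))).const_mul _).const_mul _

/-! ## §2 The identity-theorem step: the pairing equals the four-term on the diagonal -/

/-- **THE DIAGONAL χ FOUR-TERM IDENTITY ON `D₁` FROM THE TUBE RELATION** (twin of ★ `diag_eq_fourTerm_of_pairing_on'`): `D₁ ⊆ D⁺` open preconnected with two sub-tube boxes
`O₁, O₂′ ⊆ D₁` (`2 < Re z′ < Re z` on `O₁ × O₂′`), `w` holomorphic on `D₁`, the kernel `B` separately holomorphic ∕ anti-holomorphic (`hB₁`, `hB₂`), a pairing `Φ` holomorphic ∕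
anti-holomorphic with `Φ = R_χ₂` whenever `2 < Re z′ < Re z` in `D₁`; THEN `Φ z z = R_χ₂(z, z)` for every `z ∈ D₁` (★ `eqOn_prod_of_separately_differentiableOn` on `D₁ × conj⁻¹D₁`, then the
diagonal `u = conj z`). [cite: MoeglinWaldspurger1995, IV.2.3, IV.3.12 (a)] [cite: Arthur1980TraceFormulaII, §4] -/
theorem diag_eq_chiFourTerm₂_of_pairing {D₁ : Set ℂ} (hD₁ : IsOpen D₁) (hD₁c : IsPreconnected D₁) (hD₁sub : D₁ ⊆ {z : ℂ | 1 < z.re ∧ 0 < z.im})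
    {O₁ O₂' : Set ℂ} (hO₁ : IsOpen O₁) (hO₁ne : O₁.Nonempty) (hO₁D : O₁ ⊆ D₁) (hO₂' : IsOpen O₂') (hO₂'ne : O₂'.Nonempty) (hO₂'D : O₂' ⊆ D₁)
    (hsep : ∀ z ∈ O₁, ∀ z' ∈ O₂', 2 < z'.re ∧ z'.re < z.re)
    (Cμ CK a : ℝ) {T : ℝ} (hT : 0 < T)
    {w : ℂ → ℂ} (hw : DifferentiableOn ℂ w D₁) {B : ℂ → ℂ → ℂ} (hB₁ : ∀ z' ∈ D₁, DifferentiableOn ℂ (fun z : ℂ => B z z') D₁)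
    (hB₂ : ∀ z ∈ D₁, DifferentiableOn ℂ (fun u : ℂ => B z (conj u)) {u : ℂ | conj u ∈ D₁})
    {Φ : ℂ → ℂ → ℂ}
    (hΦ₁ : ∀ z' ∈ D₁, DifferentiableOn ℂ (fun z : ℂ => Φ z z') D₁)
    (hΦ₂ : ∀ z ∈ D₁, DifferentiableOn ℂ (fun u : ℂ => Φ z (conj u)) {u : ℂ | conj u ∈ D₁})
    (hrel : ∀ z ∈ D₁, ∀ z' ∈ D₁, 2 < z'.re → z'.re < z.re →
      Φ z z' = ((Cμ : ℝ) : ℂ) * (((CK : ℝ) : ℂ) *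
        ((((T : ℝ) : ℂ) ^ (z + conj z' - 2) / (z + conj z' - 2)) * ((a : ℝ) : ℂ)
          + (((T : ℝ) : ℂ) ^ (z - conj z') / (z - conj z')) * conj (w z')
          - (((T : ℝ) : ℂ) ^ (-(z - conj z')) / (z - conj z')) * w z
          - (((T : ℝ) : ℂ) ^ (-(z + conj z' - 2)) / (z + conj z' - 2)) * B z z')))
    {z : ℂ} (hzD : z ∈ D₁) :
    Φ z z = ((Cμ : ℝ) : ℂ) * (((CK : ℝ) : ℂ) *
        ((((T : ℝ) : ℂ) ^ (z + conj z - 2) / (z + conj z - 2)) * ((a : ℝ) : ℂ)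
          + (((T : ℝ) : ℂ) ^ (z - conj z) / (z - conj z)) * conj (w z)
          - (((T : ℝ) : ℂ) ^ (-(z - conj z)) / (z - conj z)) * w z
          - (((T : ℝ) : ℂ) ^ (-(z + conj z - 2)) / (z + conj z - 2)) * B z z)) := by
  -- the identity in the variables `(z, u = conj z′)` on `D₁ × conj⁻¹ D₁`
  set F : ℂ → ℂ → ℂ := fun z u => Φ z (conj u) with hF_def
  set G : ℂ → ℂ → ℂ := fun z u =>
      ((Cμ : ℝ) : ℂ) * (((CK : ℝ) : ℂ) *
        ((((T : ℝ) : ℂ) ^ (z + u - 2) / (z + u - 2)) * ((a : ℝ) : ℂ)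
          + (((T : ℝ) : ℂ) ^ (z - u) / (z - u)) * conj (w (conj u))
          - (((T : ℝ) : ℂ) ^ (-(z - u)) / (z - u)) * w z
          - (((T : ℝ) : ℂ) ^ (-(z + u - 2)) / (z + u - 2)) * B z (conj u))) with hG_def
  have hD₂ : IsOpen {u : ℂ | conj u ∈ D₁} := hD₁.preimage Complex.continuous_conj
  have hD₂c : IsPreconnected {u : ℂ | conj u ∈ D₁} := by
    have h1 : {u : ℂ | conj u ∈ D₁} = (fun z : ℂ => conj z) '' D₁ := by
      ext u
      refine ⟨fun hu => ⟨conj u, hu, Complex.conj_conj u⟩, ?_⟩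
      rintro ⟨z, hz1, rfl⟩
      show conj (conj z) ∈ D₁
      rw [Complex.conj_conj]; exact hz1
    rw [h1]
    exact hD₁c.image _ Complex.continuous_conj.continuousOn
  have hF₁ : ∀ u ∈ {u : ℂ | conj u ∈ D₁}, DifferentiableOn ℂ (fun z => F z u) D₁ := fun u hu => hΦ₁ (conj u) hu
  have hG₁ : ∀ u ∈ {u : ℂ | conj u ∈ D₁}, DifferentiableOn ℂ (fun z => G z u) D₁ := fun u hu => differentiableOn_chiFourTerm₂_fst hD₁sub Cμ CK a hT hw hB₁ hu
  have hF₂ : ∀ z ∈ D₁, DifferentiableOn ℂ (fun u => F z u) {u : ℂ | conj u ∈ D₁} := fun z hz => hΦ₂ z hz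
  have hG₂ : ∀ z ∈ D₁, DifferentiableOn ℂ (fun u => G z u) {u : ℂ | conj u ∈ D₁} := fun z hz => differentiableOn_chiFourTerm₂_snd_conj hD₁ hD₁sub Cμ CK a hT hw hB₂ hz
  -- the boxes `O₁ ⊆ D₁`, `conj⁻¹ O₂′ ⊆ conj⁻¹ D₁`
  have hO₂ : IsOpen {u : ℂ | conj u ∈ O₂'} := hO₂'.preimage Complex.continuous_conj
  have hO₂ne : ({u : ℂ | conj u ∈ O₂'} : Set ℂ).Nonempty := by
    obtain ⟨z', hz'⟩ := hO₂'ne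
    exact ⟨conj z', show conj (conj z') ∈ O₂' by rw [Complex.conj_conj]; exact hz'⟩
  have hO₂D : {u : ℂ | conj u ∈ O₂'} ⊆ {u : ℂ | conj u ∈ D₁} := fun u hu => hO₂'D hu
  have heq : ∀ z ∈ O₁, ∀ u ∈ {u : ℂ | conj u ∈ O₂'}, F z u = G z u := by
    intro z hz u hu
    obtain ⟨h1, h2⟩ := hsep z hz (conj u) hu
    have h := hrel z (hO₁D hz) (conj u) (hO₂'D hu) h1 h2
    simp only [Complex.conj_conj] at h
    exact h
  have hid := eqOn_prod_of_separately_differentiableOn hD₁ hD₁c hD₂ hD₂c hO₁ hO₁ne hO₁D hO₂ hO₂ne hO₂D hF₁ hG₁ hF₂ hG₂ heq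
  have hzc : conj z ∈ {u : ℂ | conj u ∈ D₁} := by
    show conj (conj z) ∈ D₁
    rw [Complex.conj_conj]; exact hzD
  have hdiag := hid z hzD (conj z) hzc
  simp only [hF_def, hG_def, Complex.conj_conj] at hdiag
  exact hdiag

/-! ## §3 The diagonal relation for a Hilbert-valued family, upper quarter-plane domain -/

section Family

variable {H : Type*} [NormedAddCommGroup H] [InnerProductSpace ℂ H]

/-- **`‖F z‖² = R_χ₂(z, z)` ON AN UPPER QUARTER-PLANE DOMAIN, FROM THE TUBE LETTER** (twin of ★ `normSq_family_eq_fourTerm_on'`): `F : ℂ → H` holomorphic on `D₁ ⊆ D⁺` (open,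
preconnected, with sub-tube boxes), and the χ Maass–Selberg INNER-PRODUCT FORMULA on the tube inside `D₁`
`hMStube : ⟪F z′, F z⟫ = R_χ₂(z, z′; a, w, B)` for `2 < Re z′ < Re z` ([MoeglinWaldspurger1995, IV.2.3] for truncated χ-Eisenstein series); then for every `z ∈ D₁`:
`(‖F z‖² : ℂ) = R_χ₂(z, z)`.  The pairing is holomorphic ∕ anti-holomorphic by ★ `pairing_of_differentiableOn`; §2 does the rest. [cite: MoeglinWaldspurger1995, IV.2.3, IV.3.12 (a)]
[cite: BernsteinLapid2019, §4] -/
theorem normSq_family_eq_chiFourTerm_of_tube {D₁ : Set ℂ} (hD₁ : IsOpen D₁) (hD₁c : IsPreconnected D₁) (hD₁sub : D₁ ⊆ {z : ℂ | 1 < z.re ∧ 0 < z.im})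
    {O₁ O₂' : Set ℂ} (hO₁ : IsOpen O₁) (hO₁ne : O₁.Nonempty) (hO₁D : O₁ ⊆ D₁) (hO₂' : IsOpen O₂') (hO₂'ne : O₂'.Nonempty) (hO₂'D : O₂' ⊆ D₁)
    (hsep : ∀ z ∈ O₁, ∀ z' ∈ O₂', 2 < z'.re ∧ z'.re < z.re)
    (Cμ CK a : ℝ) {T : ℝ} (hT : 0 < T)
    {w : ℂ → ℂ} (hw : DifferentiableOn ℂ w D₁) {B : ℂ → ℂ → ℂ} (hB₁ : ∀ z' ∈ D₁, DifferentiableOn ℂ (fun z : ℂ => B z z') D₁)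
    (hB₂ : ∀ z ∈ D₁, DifferentiableOn ℂ (fun u : ℂ => B z (conj u)) {u : ℂ | conj u ∈ D₁})
    (F : ℂ → H) (hFd : DifferentiableOn ℂ F D₁)
    (hMStube : ∀ z ∈ D₁, ∀ z' ∈ D₁, 2 < z'.re → z'.re < z.re →
      ⟪F z', F z⟫_ℂ = ((Cμ : ℝ) : ℂ) * (((CK : ℝ) : ℂ) *
        ((((T : ℝ) : ℂ) ^ (z + conj z' - 2) / (z + conj z' - 2)) * ((a : ℝ) : ℂ)
          + (((T : ℝ) : ℂ) ^ (z - conj z') / (z - conj z')) * conj (w z')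
          - (((T : ℝ) : ℂ) ^ (-(z - conj z')) / (z - conj z')) * w z
          - (((T : ℝ) : ℂ) ^ (-(z + conj z' - 2)) / (z + conj z' - 2)) * B z z')))
    {z : ℂ} (hzD : z ∈ D₁) :
    (((‖F z‖ ^ 2 : ℝ)) : ℂ) = ((Cμ : ℝ) : ℂ) * (((CK : ℝ) : ℂ) *
        ((((T : ℝ) : ℂ) ^ (z + conj z - 2) / (z + conj z - 2)) * ((a : ℝ) : ℂ)
          + (((T : ℝ) : ℂ) ^ (z - conj z) / (z - conj z)) * conj (w z)
          - (((T : ℝ) : ℂ) ^ (-(z - conj z)) / (z - conj z)) * w z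
          - (((T : ℝ) : ℂ) ^ (-(z + conj z - 2)) / (z + conj z - 2)) * B z z)) := by
  obtain ⟨hΦ₁, hΦ₂, hQ⟩ := pairing_of_differentiableOn hD₁ hFd
  rw [← (hQ z hzD).2]
  exact diag_eq_chiFourTerm₂_of_pairing hD₁ hD₁c hD₁sub hO₁ hO₁ne hO₁D hO₂' hO₂'ne hO₂'D hsep Cμ CK a hT hw hB₁ hB₂ (Φ := fun z z' => ⟪F z', F z⟫_ℂ) hΦ₁ hΦ₂ hMStube hzD

/-! ## §4 The lower quarter-plane domain, by reflection -/

/-- **`‖F ū‖² = R_χ₂(u, u; w♯, B♯)` ON A LOWER QUARTER-PLANE DOMAIN, FROM THE TUBE LETTER** (twin of ★ `normSq_family_eq_fourTerm_lower_on'`): `D₂ ⊆ D⁻ = {1 < Re, Im < 0}` open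
preconnected with sub-tube boxes, `F` holomorphic on `D₂`, the SAME tube letter on `D₂` (the Maass–Selberg formula holds on the whole convergence tube), `w` holomorphic on `D₂`, the kernel
clauses `hB₁`, `hB₂` on `D₂`.  Proof: the reflected pairing `Φ′(u, u′) = ⟪F ū, F ū′⟫` on `conj⁻¹D₂ ⊆ D⁺` is holomorphic ∕ anti-holomorphic (★ `pairing_of_differentiableOn`) and equals
`conj R_χ₂(ū, ū′; w, B) = R_χ₂(u, u′; w♯, B♯)` on the reflected boxes (§1), so §2 applies with the reflected scalars (holomorphic by ★ `differentiableOn_conj_comp_conj`).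
[cite: MoeglinWaldspurger1995, IV.2.3, IV.3.12 (a)] [cite: BernsteinLapid2019, §4] -/
theorem normSq_family_eq_chiFourTerm_lower_of_tube {D₂ : Set ℂ} (hD₂ : IsOpen D₂) (hD₂c : IsPreconnected D₂) (hD₂sub : D₂ ⊆ {z : ℂ | 1 < z.re ∧ z.im < 0})
    {O₁ O₂' : Set ℂ} (hO₁ : IsOpen O₁) (hO₁ne : O₁.Nonempty) (hO₁D : O₁ ⊆ D₂) (hO₂' : IsOpen O₂') (hO₂'ne : O₂'.Nonempty) (hO₂'D : O₂' ⊆ D₂)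
    (hsep : ∀ z ∈ O₁, ∀ z' ∈ O₂', 2 < z'.re ∧ z'.re < z.re)
    (Cμ CK a : ℝ) {T : ℝ} (hT : 0 < T)
    {w : ℂ → ℂ} (hw : DifferentiableOn ℂ w D₂) {B : ℂ → ℂ → ℂ} (hB₁ : ∀ z' ∈ D₂, DifferentiableOn ℂ (fun z : ℂ => B z z') D₂)
    (hB₂ : ∀ z ∈ D₂, DifferentiableOn ℂ (fun u : ℂ => B z (conj u)) {u : ℂ | conj u ∈ D₂})
    (F : ℂ → H) (hFd : DifferentiableOn ℂ F D₂)
    (hMStube : ∀ z ∈ D₂, ∀ z' ∈ D₂, 2 < z'.re → z'.re < z.re →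
      ⟪F z', F z⟫_ℂ = ((Cμ : ℝ) : ℂ) * (((CK : ℝ) : ℂ) *
        ((((T : ℝ) : ℂ) ^ (z + conj z' - 2) / (z + conj z' - 2)) * ((a : ℝ) : ℂ)
          + (((T : ℝ) : ℂ) ^ (z - conj z') / (z - conj z')) * conj (w z')
          - (((T : ℝ) : ℂ) ^ (-(z - conj z')) / (z - conj z')) * w z
          - (((T : ℝ) : ℂ) ^ (-(z + conj z' - 2)) / (z + conj z' - 2)) * B z z')))
    {u : ℂ} (huD : conj u ∈ D₂) :
    (((‖F (conj u)‖ ^ 2 : ℝ)) : ℂ) = ((Cμ : ℝ) : ℂ) * (((CK : ℝ) : ℂ) *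
        ((((T : ℝ) : ℂ) ^ (u + conj u - 2) / (u + conj u - 2)) * ((a : ℝ) : ℂ)
          + (((T : ℝ) : ℂ) ^ (u - conj u) / (u - conj u)) * conj (conj (w (conj u)))
          - (((T : ℝ) : ℂ) ^ (-(u - conj u)) / (u - conj u)) * conj (w (conj u))
          - (((T : ℝ) : ℂ) ^ (-(u + conj u - 2)) / (u + conj u - 2)) * conj (B (conj u) (conj u)))) := by
  -- the reflected domain `D := conj⁻¹ D₂ ⊆ D⁺` and its boxes
  have hD : IsOpen {u : ℂ | conj u ∈ D₂} := hD₂.preimage Complex.continuous_conj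
  have himage : ∀ S : Set ℂ, {u : ℂ | conj u ∈ S} = (fun z : ℂ => conj z) '' S := fun S => by
    ext u
    refine ⟨fun hu => ⟨conj u, hu, Complex.conj_conj u⟩, ?_⟩
    rintro ⟨z, hz1, rfl⟩
    show conj (conj z) ∈ S
    rw [Complex.conj_conj]; exact hz1
  have hDc : IsPreconnected {u : ℂ | conj u ∈ D₂} := by rw [himage]; exact hD₂c.image _ Complex.continuous_conj.continuousOn
  have hDsub : {u : ℂ | conj u ∈ D₂} ⊆ {z : ℂ | 1 < z.re ∧ 0 < z.im} := fun u hu => by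
    obtain ⟨h1, h2⟩ := hD₂sub hu
    rw [Complex.conj_re] at h1
    rw [Complex.conj_im] at h2
    exact ⟨h1, by linarith⟩
  have hO₁r : IsOpen {u : ℂ | conj u ∈ O₁} := hO₁.preimage Complex.continuous_conj
  have hO₁rne : ({u : ℂ | conj u ∈ O₁} : Set ℂ).Nonempty := by
    obtain ⟨z, hz⟩ := hO₁ne
    exact ⟨conj z, show conj (conj z) ∈ O₁ by rw [Complex.conj_conj]; exact hz⟩
  have hO₁rD : {u : ℂ | conj u ∈ O₁} ⊆ {u : ℂ | conj u ∈ D₂} := fun u hu => hO₁D hu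
  have hO₂r : IsOpen {u : ℂ | conj u ∈ O₂'} := hO₂'.preimage Complex.continuous_conj
  have hO₂rne : ({u : ℂ | conj u ∈ O₂'} : Set ℂ).Nonempty := by
    obtain ⟨z, hz⟩ := hO₂'ne
    exact ⟨conj z, show conj (conj z) ∈ O₂' by rw [Complex.conj_conj]; exact hz⟩
  have hO₂rD : {u : ℂ | conj u ∈ O₂'} ⊆ {u : ℂ | conj u ∈ D₂} := fun u hu => hO₂'D hu
  have hsepr : ∀ u ∈ {u : ℂ | conj u ∈ O₁}, ∀ u' ∈ {u : ℂ | conj u ∈ O₂'}, 2 < u'.re ∧ u'.re < u.re := by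
    intro u hu u' hu'
    have h := hsep (conj u) hu (conj u') hu'
    rwa [Complex.conj_re, Complex.conj_re] at h
  -- the reflected scalars are holomorphic ∕ anti-holomorphic on the reflected domain
  have hwr : DifferentiableOn ℂ (fun u : ℂ => conj (w (conj u))) {u : ℂ | conj u ∈ D₂} := differentiableOn_conj_comp_conj hD₂ hw
  have hB₁r : ∀ u' ∈ {u : ℂ | conj u ∈ D₂}, DifferentiableOn ℂ (fun u : ℂ => conj (B (conj u) (conj u'))) {u : ℂ | conj u ∈ D₂} :=
    fun u' hu' => differentiableOn_conj_comp_conj hD₂ (hB₁ (conj u') hu')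
  have hB₂r : ∀ u ∈ {u : ℂ | conj u ∈ D₂}, DifferentiableOn ℂ (fun v : ℂ => conj (B (conj u) (conj (conj v)))) {v : ℂ | conj v ∈ {u : ℂ | conj u ∈ D₂}} :=
    fun u hu => differentiableOn_conj_comp_conj hD (hB₂ (conj u) hu)
  -- the reflected pairing
  obtain ⟨hΦ₁, hΦ₂, hQ⟩ := pairing_of_differentiableOn hD₂ hFd
  have hP₁ : ∀ u' ∈ {u : ℂ | conj u ∈ D₂}, DifferentiableOn ℂ (fun u : ℂ => ⟪F (conj u), F (conj u')⟫_ℂ) {u : ℂ | conj u ∈ D₂} := fun u' hu' => hΦ₂ (conj u') hu'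
  have hP₂ : ∀ u ∈ {u : ℂ | conj u ∈ D₂}, DifferentiableOn ℂ (fun v : ℂ => ⟪F (conj u), F (conj (conj v))⟫_ℂ) {v : ℂ | conj v ∈ {u : ℂ | conj u ∈ D₂}} := by
    intro u hu
    have hset : {v : ℂ | conj v ∈ {u : ℂ | conj u ∈ D₂}} = D₂ := by
      ext v
      simp only [Set.mem_setOf_eq, Complex.conj_conj]
    rw [hset]
    refine (hΦ₁ (conj u) hu).congr fun v _ => ?_
    rw [Complex.conj_conj]
  have hrel : ∀ u ∈ {u : ℂ | conj u ∈ D₂}, ∀ u' ∈ {u : ℂ | conj u ∈ D₂}, 2 < u'.re → u'.re < u.re →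
      ⟪F (conj u), F (conj u')⟫_ℂ = ((Cμ : ℝ) : ℂ) * (((CK : ℝ) : ℂ) *
        ((((T : ℝ) : ℂ) ^ (u + conj u' - 2) / (u + conj u' - 2)) * ((a : ℝ) : ℂ)
          + (((T : ℝ) : ℂ) ^ (u - conj u') / (u - conj u')) * conj (conj (w (conj u')))
          - (((T : ℝ) : ℂ) ^ (-(u - conj u')) / (u - conj u')) * conj (w (conj u))
          - (((T : ℝ) : ℂ) ^ (-(u + conj u' - 2)) / (u + conj u' - 2)) * conj (B (conj u) (conj u')))) := by
    intro u hu u' hu' h1 h2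
    have ht := hMStube (conj u) hu (conj u') hu' (by rwa [Complex.conj_re]) (by rwa [Complex.conj_re, Complex.conj_re])
    rw [← inner_conj_symm, ht, ← conj_chiFourTerm₂ Cμ CK a hT.le w B u u']
  have hdiag := diag_eq_chiFourTerm₂_of_pairing hD hDc hDsub hO₁r hO₁rne hO₁rD hO₂r hO₂rne hO₂rD hsepr Cμ CK a hT hwr hB₁r hB₂r
    (Φ := fun u u' => ⟪F (conj u), F (conj u')⟫_ℂ) hP₁ hP₂ hrel huD
  rw [← (hQ (conj u) huD).2]
  simpa only [Complex.conj_conj] using hdiag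

/-! ## §5 HEAD: the relation letter of ★ `msBound_of_chiRelation` near a real pole -/

/-- **THE THREE-SCALAR DIAGONAL MAASS–SELBERG RELATION OFF THE REAL AXIS NEAR A REAL POINT `z₀`** — the `hMSrel` letter of ★
`K2E1ChiEisensteinL2BoundMiddlePoleCMThree.msBound_of_chiRelation` with `β z := B z z`: from an UPPER domain `D₁ ⊆ D⁺` and a LOWER domain `D₂ ⊆ D⁻` (open, preconnected, sub-tube
boxes) covering the punctured neighbourhood of `z₀` off the real axis (`hD₁ev`, `hD₂ev`), the family holomorphic on both, the χ Maass–Selberg INNER-PRODUCT FORMULA on both tubes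
(`hMStube₁`, `hMStube₂` — the same formula, [MoeglinWaldspurger1995, IV.2.3]), and holomorphy of `w` and of the kernel `B` on both: `∀ᶠ z in 𝓝[≠] z₀, Im z ≠ 0 → ‖F z‖² ≤ ‖R_χ(z; a, w z, B z z)‖`
(an EQUALITY of norms: §3 above, §4 below the axis — there the right side appears conjugated, with the same norm). [cite: MoeglinWaldspurger1995, IV.2.3, IV.3.12 (a)] [cite: Langlands1976, §7] -/
theorem msRel_of_tube_letters (z₀ : ℝ)
    {D₁ : Set ℂ} (hD₁ : IsOpen D₁) (hD₁c : IsPreconnected D₁) (hD₁sub : D₁ ⊆ {z : ℂ | 1 < z.re ∧ 0 < z.im})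
    {O₁ O₂' : Set ℂ} (hO₁ : IsOpen O₁) (hO₁ne : O₁.Nonempty) (hO₁D : O₁ ⊆ D₁) (hO₂' : IsOpen O₂') (hO₂'ne : O₂'.Nonempty) (hO₂'D : O₂' ⊆ D₁)
    (hsep : ∀ z ∈ O₁, ∀ z' ∈ O₂', 2 < z'.re ∧ z'.re < z.re)
    {D₂ : Set ℂ} (hD₂ : IsOpen D₂) (hD₂c : IsPreconnected D₂) (hD₂sub : D₂ ⊆ {z : ℂ | 1 < z.re ∧ z.im < 0})
    {Q₁ Q₂' : Set ℂ} (hQ₁ : IsOpen Q₁) (hQ₁ne : Q₁.Nonempty) (hQ₁D : Q₁ ⊆ D₂) (hQ₂' : IsOpen Q₂') (hQ₂'ne : Q₂'.Nonempty) (hQ₂'D : Q₂' ⊆ D₂)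
    (hsep₂ : ∀ z ∈ Q₁, ∀ z' ∈ Q₂', 2 < z'.re ∧ z'.re < z.re)
    (hD₁ev : ∀ᶠ z : ℂ in 𝓝[≠] (z₀ : ℂ), 0 < z.im → z ∈ D₁) (hD₂ev : ∀ᶠ z : ℂ in 𝓝[≠] (z₀ : ℂ), z.im < 0 → z ∈ D₂)
    (Cμ CK a : ℝ) {T : ℝ} (hT : 0 < T)
    {w : ℂ → ℂ} (hw₁ : DifferentiableOn ℂ w D₁) (hw₂ : DifferentiableOn ℂ w D₂)
    {B : ℂ → ℂ → ℂ} (hB₁ : ∀ z' ∈ D₁, DifferentiableOn ℂ (fun z : ℂ => B z z') D₁) (hB₂ : ∀ z ∈ D₁, DifferentiableOn ℂ (fun u : ℂ => B z (conj u)) {u : ℂ | conj u ∈ D₁})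
    (hB₁' : ∀ z' ∈ D₂, DifferentiableOn ℂ (fun z : ℂ => B z z') D₂) (hB₂' : ∀ z ∈ D₂, DifferentiableOn ℂ (fun u : ℂ => B z (conj u)) {u : ℂ | conj u ∈ D₂})
    (F : ℂ → H) (hFd₁ : DifferentiableOn ℂ F D₁) (hFd₂ : DifferentiableOn ℂ F D₂)
    (hMStube₁ : ∀ z ∈ D₁, ∀ z' ∈ D₁, 2 < z'.re → z'.re < z.re →
      ⟪F z', F z⟫_ℂ = ((Cμ : ℝ) : ℂ) * (((CK : ℝ) : ℂ) *
        ((((T : ℝ) : ℂ) ^ (z + conj z' - 2) / (z + conj z' - 2)) * ((a : ℝ) : ℂ)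
          + (((T : ℝ) : ℂ) ^ (z - conj z') / (z - conj z')) * conj (w z')
          - (((T : ℝ) : ℂ) ^ (-(z - conj z')) / (z - conj z')) * w z
          - (((T : ℝ) : ℂ) ^ (-(z + conj z' - 2)) / (z + conj z' - 2)) * B z z')))
    (hMStube₂ : ∀ z ∈ D₂, ∀ z' ∈ D₂, 2 < z'.re → z'.re < z.re →
      ⟪F z', F z⟫_ℂ = ((Cμ : ℝ) : ℂ) * (((CK : ℝ) : ℂ) *
        ((((T : ℝ) : ℂ) ^ (z + conj z' - 2) / (z + conj z' - 2)) * ((a : ℝ) : ℂ)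
          + (((T : ℝ) : ℂ) ^ (z - conj z') / (z - conj z')) * conj (w z')
          - (((T : ℝ) : ℂ) ^ (-(z - conj z')) / (z - conj z')) * w z
          - (((T : ℝ) : ℂ) ^ (-(z + conj z' - 2)) / (z + conj z' - 2)) * B z z'))) :
    ∀ᶠ z : ℂ in 𝓝[≠] (z₀ : ℂ), z.im ≠ 0 →
      ‖F z‖ ^ 2 ≤ ‖((Cμ : ℝ) : ℂ) * (((CK : ℝ) : ℂ) *
        ((((T : ℝ) : ℂ) ^ (z + conj z - 2) / (z + conj z - 2)) * ((a : ℝ) : ℂ)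
          + (((T : ℝ) : ℂ) ^ (z - conj z) / (z - conj z)) * conj (w z)
          - (((T : ℝ) : ℂ) ^ (-(z - conj z)) / (z - conj z)) * w z
          - (((T : ℝ) : ℂ) ^ (-(z + conj z - 2)) / (z + conj z - 2)) * B z z))‖ := by
  filter_upwards [hD₁ev, hD₂ev] with z hz₁ hz₂ hzim
  rcases lt_or_gt_of_ne hzim with hneg | hpos
  · -- below the axis: §4 at `u := conj z`, then `‖conj ·‖ = ‖·‖`
    have hzD : conj (conj z) ∈ D₂ := by rw [Complex.conj_conj]; exact hz₂ hneg
    have h := normSq_family_eq_chiFourTerm_lower_of_tube hD₂ hD₂c hD₂sub hQ₁ hQ₁ne hQ₁D hQ₂' hQ₂'ne hQ₂'D hsep₂ Cμ CK a hT hw₂ hB₁' hB₂' F hFd₂ hMStube₂ hzD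
    rw [← conj_chiFourTerm₂ Cμ CK a hT.le w B (conj z) (conj z)] at h
    simp only [Complex.conj_conj] at h
    have hn := congrArg norm h
    rw [Complex.norm_real, Real.norm_eq_abs, abs_of_nonneg (sq_nonneg _), RCLike.norm_conj] at hn
    exact hn.le
  · -- above the axis: §3
    have h := normSq_family_eq_chiFourTerm_of_tube hD₁ hD₁c hD₁sub hO₁ hO₁ne hO₁D hO₂' hO₂'ne hO₂'D hsep Cμ CK a hT hw₁ hB₁ hB₂ F hFd₁ hMStube₁ (hz₁ hpos)
    have hn := congrArg norm h
    rw [Complex.norm_real, Real.norm_eq_abs, abs_of_nonneg (sq_nonneg _)] at hn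
    exact hn.le

end Family

end Summit.HodgeConjecture.HodgeConjecture.Cruxes.H413.K2E1ChiMaassSelbergDiagonalCMThree

end
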